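import Literature.NumberTheory.EllipticCurves.PlusMinusPAdicLFunctionProofs
import HarnessLib

/-!
# Crux `ResidualThetaMainConjectureAtTwo` (stmt-BirchSwinnertonDyer-20787), line `birth` v5 — toward stub (R1c)
# `stub_pollackPairKAtTwo`: Lang's completeness `𝓞⟦T⟧ = lim 𝓞[T]/(D_m)` for a FINITE FREE `ℤ_p`-algebra `𝓞`,
# by reduction to the tree's `ℤ_p` theorem coordinate by coordinate

Cell `bsd-wall`, seat `bsd-wall-rtt-p2` (LEAD PROVER, line mode, g2). THEOREMS ONLY (no `def`, no named fact, no
`sorry`); `--supports stmt-BirchSwinnertonDyer-20787`; closes nothing by itself.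

WHY. Pollack's `L^±` of the CM partner `g` live in `𝓞⟦T⟧`, `𝓞 = 𝓞_{ℚ₂(ι K_g)}`, and are obtained as LIMITS of the
signed quotients `±θ_{2m}(g)/ω^∓_{2m}` along the towers `D_m = T·ω^±_{2m} = B·∏_{i<m} ξ_i` of Eisenstein-type
polynomials (`ξ_i(0) ∈ (p)`). The tree proves the limit mechanism over `Λ = ℤ_p⟦T⟧`
(`exists_powerSeries_sub_eq_mul`: a compatible system `g_{M+1} − g_M ∈ D_M ℤ_p[T]` has a limit `L ∈ Λ` with
`L ≡ g_m (mod D_m Λ)` for every `m`; Lang, *Cyclotomic Fields*, Ch. 5 Thm. 1.1). This file transports it to ANY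
commutative `ℤ_p`-algebra `𝓞` that is finite free as a `ℤ_p`-module (the ring of integers of a finite extension of
`ℚ_p`, Neukirch II (6.8)) WITHOUT any topology on `𝓞`: choose a `ℤ_p`-basis `(b_i)` of `𝓞`; since the moduli
`D_m` have coefficients in `ℤ_p`, the coordinates of a compatible system are compatible systems over `ℤ_p`
(`coeff_coord_map_mul`), the `ℤ_p` theorem gives limits `L_i`, and `L = Σ_i b_i L_i` works
(`exists_powerSeries_sub_eq_mul_of_free`). BSD is not proved by any of this.

References: S. Lang, *Cyclotomic Fields I and II*, Ch. 5 §1 Thm. 1.1 [Lang1990]; J. Neukirch, *Algebraic Number Theory*,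
Ch. II (6.8) [NeukirchANT1999]; R. Pollack, Duke Math. J. 118 (2003) Prop. 6.18 [Pollack2003].
-/

set_option linter.dupNamespace false
set_option autoImplicit false

noncomputable section

open scoped Classical

open Polynomial Literature.NumberTheory.EllipticCurves

namespace Summit.BirchSwinnertonDyer.BirchSwinnertonDyer.Theorems.ResidualThetaLayer

section Coordinates

variable {p : ℕ} [Fact p.Prime] {O : Type*} [CommRing O] [Algebra ℤ_[p] O]
  {ι' : Type*} (b : Module.Basis ι' ℤ_[p] O) (i : ι')

/-- The `i`-th coordinate polynomial of `P ∈ 𝓞[X]` with respect to a `ℤ_p`-basis `b` of `𝓞`: its `n`-th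
coefficient is the `i`-th coordinate of the `n`-th coefficient of `P`. Spelled as a finite sum of monomials (no new
definition). [folklore] -/
theorem coeff_coord (P : O[X]) (n : ℕ) :
    (∑ k ∈ P.support, monomial k (b.repr (P.coeff k) i)).coeff n = b.repr (P.coeff n) i := by
  rw [finsetSum_coeff]
  simp only [coeff_monomial]
  rw [Finset.sum_ite_eq' P.support n]
  split_ifs with h
  · rfl
  · rw [Polynomial.notMem_support_iff.mp h, map_zero, Finsupp.zero_apply]

/-- Coordinates are additive: the coordinate polynomial of `P − Q` is the difference of those of `P` and `Q`.
[folklore] -/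
theorem coord_sub (P Q : O[X]) :
    (∑ k ∈ (P - Q).support, monomial k (b.repr ((P - Q).coeff k) i)) =
      (∑ k ∈ P.support, monomial k (b.repr (P.coeff k) i)) -
        ∑ k ∈ Q.support, monomial k (b.repr (Q.coeff k) i) := by
  ext n
  rw [coeff_sub, coeff_coord, coeff_coord, coeff_coord, coeff_sub, map_sub, Finsupp.sub_apply]

/-- **Coordinates are `ℤ_p[X]`-linear**: for `D ∈ ℤ_p[X]` and `S ∈ 𝓞[X]`, the `i`-th coordinate polynomial of
`D·S` is `D` times the `i`-th coordinate polynomial of `S`. [folklore] -/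
theorem coord_map_mul (D : ℤ_[p][X]) (S : O[X]) :
    (∑ k ∈ (D.map (algebraMap ℤ_[p] O) * S).support,
        monomial k (b.repr ((D.map (algebraMap ℤ_[p] O) * S).coeff k) i)) =
      D * ∑ k ∈ S.support, monomial k (b.repr (S.coeff k) i) := by
  ext n
  rw [coeff_coord, coeff_mul, coeff_mul, map_sum, Finsupp.coe_finsetSum, Finset.sum_apply]
  refine Finset.sum_congr rfl fun x _ ↦ ?_
  rw [coeff_map, coeff_coord, ← Algebra.smul_def, map_smul, Finsupp.smul_apply, smul_eq_mul]

/-- Reconstruction of a power series over `𝓞` from its coordinate series: coefficientwise `Σ_i (x_n)_i • b_i = x_n`.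
[folklore] -/
theorem coeff_sum_C_mul_map_eq [Fintype ι'] (F : PowerSeries O) (n : ℕ) :
    PowerSeries.coeff n (∑ j, PowerSeries.C (b j) *
        PowerSeries.map (algebraMap ℤ_[p] O) (PowerSeries.mk fun k ↦ b.repr (PowerSeries.coeff k F) j)) =
      PowerSeries.coeff n F := by
  rw [map_sum]
  simp only [PowerSeries.coeff_C_mul, PowerSeries.coeff_map, PowerSeries.coeff_mk]
  conv_rhs => rw [← b.sum_repr (PowerSeries.coeff n F)]
  refine Finset.sum_congr rfl fun j _ ↦ ?_
  rw [Algebra.smul_def, mul_comm]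

end Coordinates

section Limit

variable {p : ℕ} [hp : Fact p.Prime] {O : Type*} [CommRing O] [Algebra ℤ_[p] O]
  [Module.Free ℤ_[p] O] [Module.Finite ℤ_[p] O]

/-- **Completeness of `𝓞⟦T⟧` along a tower, for `𝓞` finite free over `ℤ_p`.** Let `ξ_0, ξ_1, …` be polynomials
over `ℤ_p` with constant terms in `(p)`, `B ∈ ℤ_p[X]`, `D_m = B·∏_{i<m} ξ_i` (read in `𝓞[X]`), and `g_0, g_1, … ∈ 𝓞[X]`
with `g_{M+1} − g_M ∈ D_M·𝓞[X]`. Then there is `L ∈ 𝓞⟦T⟧` with `L ≡ g_m (mod D_m·𝓞⟦T⟧)` for every `m` — the tree's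
`exists_powerSeries_sub_eq_mul` (the case `𝓞 = ℤ_p`) applied to the coordinates in a `ℤ_p`-basis of `𝓞`.
[cite: Lang1990, Ch. 5 §1 Thm. 1.1] [cite: NeukirchANT1999, Ch. II (6.8)] -/
theorem exists_powerSeries_sub_eq_mul_of_free (B : ℤ_[p][X]) (ξ : ℕ → ℤ_[p][X])
    (hξ : ∀ i, (p : ℤ_[p]) ∣ (ξ i).coeff 0) (g s : ℕ → O[X])
    (hg : ∀ M, g (M + 1) - g M = (B * ∏ i ∈ Finset.range M, ξ i).map (algebraMap ℤ_[p] O) * s M) :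
    ∃ L : PowerSeries O, ∀ m, ∃ Q : PowerSeries O,
      L - (g m : PowerSeries O) =
        (((B * ∏ i ∈ Finset.range m, ξ i).map (algebraMap ℤ_[p] O) : O[X]) : PowerSeries O) * Q := by
  classical
  set b := Module.Free.chooseBasis ℤ_[p] O with hb
  haveI : Fintype (Module.Free.ChooseBasisIndex ℤ_[p] O) := Module.Free.ChooseBasisIndex.fintype ℤ_[p] O
  -- coordinates
  set crd : Module.Free.ChooseBasisIndex ℤ_[p] O → O[X] → ℤ_[p][X] :=
    fun i P ↦ ∑ k ∈ P.support, monomial k (b.repr (P.coeff k) i) with hcrd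
  have hcoeff : ∀ i P n, (crd i P).coeff n = b.repr (P.coeff n) i := fun i P n ↦ coeff_coord b i P n
  -- per-coordinate compatible systems
  have hgi : ∀ i M, crd i (g (M + 1)) - crd i (g M) =
      B * (∏ k ∈ Finset.range M, ξ k) * crd i (s M) := by
    intro i M
    rw [hcrd, ← coord_sub b i, hg M, coord_map_mul b i]
  -- limits over `ℤ_p`
  have hLi : ∀ i, ∃ Li : PowerSeries ℤ_[p], ∀ m, ∃ Q : PowerSeries ℤ_[p],
      Li - (crd i (g m) : PowerSeries ℤ_[p]) =
        ((B * ∏ k ∈ Finset.range m, ξ k : ℤ_[p][X]) : PowerSeries ℤ_[p]) * Q :=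
    fun i ↦ exists_powerSeries_sub_eq_mul B ξ hξ (fun M ↦ crd i (g M)) (fun M ↦ crd i (s M)) (hgi i)
  choose Li hLi' using hLi
  refine ⟨∑ j, PowerSeries.C (b j) * PowerSeries.map (algebraMap ℤ_[p] O) (Li j), fun m ↦ ?_⟩
  choose Q hQ using fun j ↦ hLi' j m
  refine ⟨∑ j, PowerSeries.C (b j) * PowerSeries.map (algebraMap ℤ_[p] O) (Q j), ?_⟩
  -- reconstruction of `g m` from its coordinates
  have hrec : (g m : PowerSeries O) =
      ∑ j, PowerSeries.C (b j) * PowerSeries.map (algebraMap ℤ_[p] O) (crd j (g m) : PowerSeries ℤ_[p]) := by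
    have h1 : ∀ j, ((crd j (g m) : ℤ_[p][X]) : PowerSeries ℤ_[p]) =
        PowerSeries.mk fun k ↦ b.repr (PowerSeries.coeff k (g m : PowerSeries O)) j := by
      intro j
      ext k
      rw [Polynomial.coeff_coe, hcoeff, PowerSeries.coeff_mk, Polynomial.coeff_coe]
    simp_rw [h1]
    ext n
    rw [coeff_sum_C_mul_map_eq b]
  set D : ℤ_[p][X] := B * ∏ k ∈ Finset.range m, ξ k with hD
  have hDcoe : (((D.map (algebraMap ℤ_[p] O) : O[X])) : PowerSeries O) =
      PowerSeries.map (algebraMap ℤ_[p] O) (D : PowerSeries ℤ_[p]) := by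
    rw [Polynomial.polynomial_map_coe]
  rw [hrec, ← Finset.sum_sub_distrib, hDcoe, Finset.mul_sum]
  refine Finset.sum_congr rfl fun j _ ↦ ?_
  rw [← mul_sub, ← map_sub, hQ j, map_mul]
  ring

end Limit

end Summit.BirchSwinnertonDyer.BirchSwinnertonDyer.Theorems.ResidualThetaLayer

end
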